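import Literature.NumberTheory.EllipticCurves.SelmerImage
import Literature.NumberTheory.EllipticCurves.SubgroupSelmer
import HarnessLib

/-!
# Change of level `H¹(K, E[d]) → H¹(K, E[n])` (`d ∣ n`) and `Sel^(d)(E/K) ↪ Sel^(n)(E/K)` for `d ∥ n`

For a Weierstrass curve `W` (an elliptic curve `E`) over a field `K` and integers `d ∣ n`, the
inclusion of Galois modules `E[d] ↪ E[n]` induces `H¹(K, E[d]) → H¹(K, E[n])` (Mathlib's
`ContinuousCohomology.map` through the tree's compatible-pair interface
`Literature.NumberTheory.EllipticCurves.resH1Hom`); over a number field it is compatible with the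
maps to `H¹(K, E)` and therefore carries the `d`-Selmer group into the `n`-Selmer group (both are
the preimages of `Ш(E/K)`, `WeierstrassCurve.selmerGroup_eq_comap_sha`). These are the transition
maps of Matsuno's `Sel_{p^∞}(E/K) = lim Sel_{p^m}(E/K)` "under the maps induced by the natural
inclusions `E[p^m] ↪ E[p^{m+1}]`" (K. Matsuno, Math. Res. Lett. 16 (2009), §2, p. 451).

When `d` is a unitary divisor of `n` (`d ∣ n` and `(d, n/d) = 1`, e.g. `d = p^{v_p(n)}`), the
inclusion `E[d] ↪ E[n]` is split by multiplication by any `m ≡ 1 (mod d)`, `m ≡ 0 (mod n/d)`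
(`E[n] = E[d] ⊕ E[n/d]`, Chinese remainder theorem), so by functoriality `H¹(K, E[d]) → H¹(K, E[n])`
has a left inverse and is injective (`torsionH1OfDvd_injective`,
`torsionH1OfDvd_injective_of_coprime`). This is the formal content of the decomposition
`Sel_n(E/K) ⊇ ⊕_{p^e ∥ n} Sel_{p^e}(E/K)` used silently in the proof of Matsuno's Proposition 4.3
for composite `n` ("the assertion follows immediately from Corollary 3.3", p. 455, Corollary 3.3
being stated for prime powers `p^e`).

Everything here is proved (functoriality bookkeeping: `resH1Hom_id`, `resH1Hom_comp`,
`resH1Hom_congr` of `SubgroupSelmer`; no number theory). Declarations about Weierstrass curves are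
deliberate dot-notation extensions in `namespace WeierstrassCurve`, as in the sibling files
`Selmer`, `SelmerImage`, `SelmerCorankAssembly`; the one piece of generic arithmetic (the
Chinese-remainder lemma `exists_dvd_mul_and_dvd_sub_one`) lives in the directory namespace
`Literature.NumberTheory.EllipticCurves`, as the generic glue of `GaloisAction` / `SubgroupSelmer`.

## References

* [Matsuno2009] K. Matsuno, *Elliptic curves with large Tate–Shafarevich groups over a number
  field*, Math. Res. Lett. 16 (2009), 449–461: §2 (p. 451, `Sel_n`, the transition maps) and the
  proof of Proposition 4.3 (p. 455).
* [SerreGaloisCohomology1997] J.-P. Serre, *Galois Cohomology* (1997), I.§2.4 (compatible pairs,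
  functoriality of `H¹`).
* [SilvermanAEC2009] J. H. Silverman, *The Arithmetic of Elliptic Curves*, 2nd ed., X.§4.
-/

noncomputable section

open scoped Classical

universe u

/-! ## Arithmetic: unitary divisors split (Chinese remainder) -/

namespace Literature.NumberTheory.EllipticCurves

/-- **Unitary divisors split**: for natural numbers `d ∣ n` with `(d, n/d) = 1` there is `m : ℤ`
with `n ∣ d m` and `d ∣ m - 1` (Chinese remainder: `m ≡ 1 (mod d)`, `m ≡ 0 (mod n/d)`); then
multiplication by `m` is the projection `ℤ/n = ℤ/d × ℤ/(n/d) → ℤ/d`, and on an abelian group it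
maps `A[n]` onto the direct summand `A[d]`. [folklore] -/
theorem exists_dvd_mul_and_dvd_sub_one {d n : ℕ} (hd : d ∣ n) (hcop : d.Coprime (n / d)) :
    ∃ m : ℤ, (n : ℤ) ∣ d * m ∧ (d : ℤ) ∣ m - 1 := by
  obtain ⟨m, hm1, hm0⟩ := Nat.chineseRemainder hcop 1 0
  refine ⟨m, ?_, ?_⟩
  · have h0 : n / d ∣ m := Nat.modEq_zero_iff_dvd.mp hm0
    have h1 : n ∣ d * m := by
      rw [← Nat.div_mul_cancel hd, mul_comm (n / d) d]
      exact Nat.mul_dvd_mul_left d h0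
    exact_mod_cast h1
  · have h1 := Nat.modEq_iff_dvd.mp hm1.symm
    push_cast at h1
    exact h1

end Literature.NumberTheory.EllipticCurves

namespace WeierstrassCurve

open Literature.NumberTheory.EllipticCurves

variable {K : Type u} [Field K] (W : WeierstrassCurve K)

/-! ## `E[d] ⊆ E[n]` and the induced map on `H¹` -/

/-- `E[d] ⊆ E[n]` inside `E(K̄)` when `d ∣ n` (Mathlib's `Submodule.torsionBy_le_torsionBy_of_dvd`,
specialised for rewriting). Silverman, *AEC*, III.§6. [folklore] -/
theorem geomTorsion_le_of_dvd {d n : ℤ} (h : d ∣ n) : geomTorsion W d ≤ geomTorsion W n :=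
  Submodule.torsionBy_le_torsionBy_of_dvd d n h

/-- **The change-of-level map `H¹(K, E[d]) → H¹(K, E[n])`** for `d ∣ n`, induced by the inclusion
of `Γ_K`-modules `E[d] ↪ E[n]`: the map of the compatible pair `(id : Γ_K → Γ_K, E[d] ↪ E[n])`
(`Literature.NumberTheory.EllipticCurves.resH1Hom`, i.e. Mathlib's `ContinuousCohomology.map`).
Matsuno (2009), §2, p. 451 (the maps `Sel_{p^m} → Sel_{p^{m+1}}` "induced by the natural
inclusions `E[p^m] ↪ E[p^{m+1}]`"); Serre, *Galois Cohomology*, I.§2.4. [folklore] -/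
def torsionH1OfDvd {d n : ℤ} (h : d ∣ n) : galH1Torsion W d →+ galH1Torsion W n :=
  resH1Hom (ContinuousMonoidHom.id (Field.absoluteGaloisGroup K))
    (AddSubgroup.inclusion (geomTorsion_le_of_dvd W h)) fun _ _ ↦ rfl

/-- **Compatibility with `H¹(K, E[·]) → H¹(K, E)`**: the triangle
`H¹(K, E[d]) → H¹(K, E[n]) → H¹(K, E)` commutes with `H¹(K, E[d]) → H¹(K, E)` (functoriality of
`H¹` in the coefficients, `resH1Hom_comp`: both are the map of the pair `(id, E[d] ↪ E(K̄))`).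
Serre, *Galois Cohomology*, I.§2.4. [folklore] -/
theorem torsionH1ToH1_comp_torsionH1OfDvd {d n : ℤ} (h : d ∣ n) :
    (torsionH1ToH1 W n).comp (torsionH1OfDvd W h) = torsionH1ToH1 W d := by
  -- `torsionH1ToH1 W m` is by definition the map of the pair `(id, E[m] ↪ E(K̄))`
  -- (`WeierstrassCurve.torsionH1ToH1_eq_resH1Hom` of `SelmerCorankAssembly`, `rfl`)
  change (resH1Hom (ContinuousMonoidHom.id (Field.absoluteGaloisGroup K))
      (geomTorsion W n).subtype (fun _ _ ↦ rfl)).comp (torsionH1OfDvd W h) =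
    resH1Hom (ContinuousMonoidHom.id (Field.absoluteGaloisGroup K)) (geomTorsion W d).subtype
      (fun _ _ ↦ rfl)
  rw [torsionH1OfDvd, resH1Hom_comp]
  exact resH1Hom_congr rfl (AddMonoidHom.ext fun _ ↦ rfl) _ _

/-- Pointwise form of `torsionH1ToH1_comp_torsionH1OfDvd`. [folklore] -/
theorem torsionH1ToH1_torsionH1OfDvd {d n : ℤ} (h : d ∣ n) (c : galH1Torsion W d) :
    torsionH1ToH1 W n (torsionH1OfDvd W h c) = torsionH1ToH1 W d c := by
  rw [← torsionH1ToH1_comp_torsionH1OfDvd W h]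
  rfl

section NumberField

variable [NumberField K]

/-- **`H¹(K, E[d]) → H¹(K, E[n])` maps `Sel^(d)(E/K)` into `Sel^(n)(E/K)`** (`d ∣ n`): both
Selmer groups are the preimages of `Ш(E/K)` under the maps to `H¹(K, E)`
(`selmerGroup_eq_comap_sha`), which are compatible (`torsionH1ToH1_torsionH1OfDvd`).
Matsuno (2009), §2, p. 451; Silverman, *AEC*, X.§4. [folklore] -/
theorem torsionH1OfDvd_mem_selmerGroup {d n : ℤ} (h : d ∣ n) {c : galH1Torsion W d}
    (hc : c ∈ selmerGroup W d) : torsionH1OfDvd W h c ∈ selmerGroup W n := by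
  rw [selmerGroup_eq_comap_sha, AddSubgroup.mem_comap] at hc ⊢
  rwa [torsionH1ToH1_torsionH1OfDvd]

end NumberField

/-! ## Splitting `E[n] → E[d]` for a unitary divisor and injectivity -/

/-- **Multiplication by `m` as a map `E[n] → E[d]`**, for `m : ℤ` with `n ∣ d m` (so that
`d (m P) = 0` for `P ∈ E[n]`); `Γ_K`-equivariant. For `d ∥ n` and `m ≡ 1 (d)`, `m ≡ 0 (n/d)` it
is the projection of `E[n] = E[d] ⊕ E[n/d]` onto `E[d]`. [folklore] -/
def geomTorsionZSMul {d n : ℤ} (m : ℤ) (hm : n ∣ d * m) : geomTorsion W n →+ geomTorsion W d :=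
  AddMonoidHom.mk' (fun P => ⟨m • (P : geomPoints W), by
      refine (Submodule.mem_torsionBy_iff d _).mpr ?_
      have hP : n • (P : geomPoints W) = 0 := (Submodule.mem_torsionBy_iff n _).mp P.2
      obtain ⟨k, hk⟩ := hm
      rw [smul_smul, hk, mul_comm, mul_smul, hP, smul_zero]⟩)
    fun P Q => Subtype.ext (smul_add m (P : geomPoints W) Q)

/-- Unfolding `geomTorsionZSMul`: `(m · P : E(K̄)) = m • P`. [folklore] -/
@[simp]
theorem coe_geomTorsionZSMul {d n : ℤ} (m : ℤ) (hm : n ∣ d * m) (P : geomTorsion W n) :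
    ((geomTorsionZSMul W m hm P : geomTorsion W d) : geomPoints W) = m • (P : geomPoints W) :=
  rfl

/-- `geomTorsionZSMul` commutes with the Galois action. [folklore] -/
theorem geomTorsionZSMul_smul {d n : ℤ} (m : ℤ) (hm : n ∣ d * m) (σ : Field.absoluteGaloisGroup K)
    (P : geomTorsion W n) :
    geomTorsionZSMul W m hm (σ • P) = σ • geomTorsionZSMul W m hm P :=
  Subtype.ext <| by
    change m • (σ • (P : geomPoints W)) = σ • (m • (P : geomPoints W))
    exact smul_comm m σ (P : geomPoints W)

/-- **Multiplication by `m ≡ 1 (mod d)` splits `E[d] ↪ E[n]`**: for `P ∈ E[d]`,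
`m P = P + ((m-1)/d)(d P) = P`. [folklore] -/
theorem geomTorsionZSMul_comp_inclusion {d n : ℤ} (h : d ∣ n) (m : ℤ) (hm : n ∣ d * m)
    (hm1 : d ∣ m - 1) :
    (geomTorsionZSMul W m hm).comp (AddSubgroup.inclusion (geomTorsion_le_of_dvd W h)) =
      AddMonoidHom.id _ := by
  refine AddMonoidHom.ext fun P => Subtype.ext ?_
  have hP : d • ((P : geomTorsion W d) : geomPoints W) = 0 := (Submodule.mem_torsionBy_iff d _).mp P.2
  obtain ⟨k, hk⟩ := hm1
  have hm' : m = 1 + d * k := by rw [← hk]; ring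
  change m • ((P : geomTorsion W d) : geomPoints W) = (P : geomPoints W)
  rw [hm', add_smul, one_smul, mul_comm, mul_smul, hP, smul_zero, add_zero]

/-- **Injectivity of `H¹(K, E[d]) → H¹(K, E[n])` for a split inclusion.** If some `m : ℤ` has
`n ∣ d m` and `d ∣ m - 1` (equivalently `d ∣ n` is a unitary divisor, `(d, n/d) = 1`), then
`H¹(K, E[d]) → H¹(K, E[n])` is injective: the map of the pair `(id, m · : E[n] → E[d])` is a left
inverse by functoriality (`resH1Hom_comp`, `resH1Hom_id`), since `(m ·) ∘ (E[d] ↪ E[n]) = id`.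
(Without the splitting the map need not be injective: the kernel of `H¹(K, E[2]) → H¹(K, E[4])`
is `E[2](K)/2E[4](K)`.) Serre, *Galois Cohomology*, I.§2.4. [folklore] -/
theorem torsionH1OfDvd_injective {d n : ℤ} (h : d ∣ n) (hm : ∃ m : ℤ, n ∣ d * m ∧ d ∣ m - 1) :
    Function.Injective (torsionH1OfDvd W h) := by
  obtain ⟨m, hm, hm1⟩ := hm
  have hr : (resH1Hom (ContinuousMonoidHom.id (Field.absoluteGaloisGroup K))
      (geomTorsionZSMul W m hm) (geomTorsionZSMul_smul W m hm)).comp (torsionH1OfDvd W h) =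
        AddMonoidHom.id _ := by
    rw [torsionH1OfDvd, resH1Hom_comp]
    exact (resH1Hom_congr
      (φ := (ContinuousMonoidHom.id (Field.absoluteGaloisGroup K)).comp
        (ContinuousMonoidHom.id (Field.absoluteGaloisGroup K)))
      (φ' := ContinuousMonoidHom.id (Field.absoluteGaloisGroup K))
      (ψ' := AddMonoidHom.id _) rfl (geomTorsionZSMul_comp_inclusion W h m hm hm1) _
      (fun _ _ ↦ rfl)).trans resH1Hom_id
  intro c c' hcc'
  have e := congrArg (resH1Hom (ContinuousMonoidHom.id (Field.absoluteGaloisGroup K))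
    (geomTorsionZSMul W m hm) (geomTorsionZSMul_smul W m hm)) hcc'
  rwa [← AddMonoidHom.comp_apply, ← AddMonoidHom.comp_apply, hr] at e

/-- **`H¹(K, E[d]) ↪ H¹(K, E[n])` for a unitary divisor `d` of `n`** (`d ∣ n`, `(d, n/d) = 1`;
e.g. `d = p^{v_p(n)}`): the case of `torsionH1OfDvd_injective` used for
`Sel_n(E/K) ⊇ ⊕_{p^e ∥ n} Sel_{p^e}(E/K)` (Matsuno (2009), proof of Proposition 4.3). [folklore] -/
theorem torsionH1OfDvd_injective_of_coprime {d n : ℕ} (hd : d ∣ n) (hcop : d.Coprime (n / d)) :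
    Function.Injective (torsionH1OfDvd W (Int.natCast_dvd_natCast.mpr hd)) :=
  torsionH1OfDvd_injective W _ (exists_dvd_mul_and_dvd_sub_one hd hcop)

section NumberField

variable [NumberField K]

/-- **`Sel^(d)(E/K) → Sel^(n)(E/K)`** for `d ∣ n`: the restriction of `torsionH1OfDvd` to the
Selmer groups (`torsionH1OfDvd_mem_selmerGroup`). Matsuno (2009), §2, p. 451. [folklore] -/
def selmerGroupOfDvd {d n : ℤ} (h : d ∣ n) : selmerGroup W d →+ selmerGroup W n :=
  ((torsionH1OfDvd W h).comp (selmerGroup W d).subtype).codRestrict (selmerGroup W n)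
    fun c => torsionH1OfDvd_mem_selmerGroup W h c.2

/-- Unfolding `selmerGroupOfDvd` on underlying classes. [folklore] -/
@[simp]
theorem coe_selmerGroupOfDvd {d n : ℤ} (h : d ∣ n) (c : selmerGroup W d) :
    ((selmerGroupOfDvd W h c : selmerGroup W n) : galH1Torsion W n) = torsionH1OfDvd W h c :=
  rfl

/-- **`Sel^(d)(E/K) ↪ Sel^(n)(E/K)` for a unitary divisor `d` of `n`** (`d ∣ n`,
`(d, n/d) = 1`). Matsuno (2009), proof of Proposition 4.3 (p. 455), where
`Sel_n = ⊕_{p^e ∥ n} Sel_{p^e}` is used to pass from Corollary 3.3 (prime powers) to all `n`.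
[folklore] -/
theorem selmerGroupOfDvd_injective_of_coprime {d n : ℕ} (hd : d ∣ n) (hcop : d.Coprime (n / d)) :
    Function.Injective (selmerGroupOfDvd W (Int.natCast_dvd_natCast.mpr hd)) := by
  intro c c' hcc'
  have e := congrArg (fun x : selmerGroup W (n : ℤ) => (x : galH1Torsion W n)) hcc'
  simp only [coe_selmerGroupOfDvd] at e
  exact Subtype.ext (torsionH1OfDvd_injective_of_coprime W hd hcop e)

end NumberField

end WeierstrassCurve

end
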